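import Summits.QuantumFields.YangMills.Theorems.F4SubCurvatureDoorHexagonPolynomial
import Mathlib
import HarnessLib

/-!
# Hexagon normal form — no POLYNOMIAL pair passes the hexagon Wick test, degenerate case `lc F = −lc G`

Support lemma toward the OPEN finite-type hexagon conjecture behind crux `stmt-QuantumFields-23125`
(`F4SubCurvatureDoor.RationalToGeneral`), continuing `F4SubCurvatureDoorHexagonPolynomial.lean` (rescaling principle).

* `hexagonPencil_noPoly_degenerate` — CASE `deg F = deg G + 3` with `lc(F) + lc(G) = 0`: then `Φ_s = F + P_s G` has degree `g + 2`
  for large `s` (top coefficient `κ − 18 s·lc(G)`), and rescaling `z = s w` with the extra normalisation `1/s` the pencil tends to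
  `−2 lc(G) w^g (3w − 4)²`, whose root `4/3` violates `Re w ≤ 1` — so `WickHexagon F G` fails for every such real polynomial pair.

Mathlib + tree helpers only; THEOREMS ONLY; no `sorry`; default heartbeats.  Nothing about crux 23125, crux 23035, any LADDER-YM
rung or the Yang–Mills mass gap is proved here.  Free-hands seat `ym-line-frs-p2` g10, `--supports stmt-QuantumFields-23125`.
-/

set_option autoImplicit false

open Filter Topology Polynomial

namespace Summit.QuantumFields.YangMills.Cruxes.RationalToGeneral.HexagonNormalForm

/-- **No polynomial pair passes the hexagon Wick test, degenerate case `deg F = deg G + 3`, `lc F + lc G = 0`.** [folklore] -/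
theorem hexagonPencil_noPoly_degenerate (F G : ℝ[X]) (hG : G ≠ 0) (hfg : F.natDegree = G.natDegree + 3)
    (hlc : F.leadingCoeff + G.leadingCoeff = 0)
    (hW : WickHexagon (fun z => Polynomial.aeval z F) (fun z => Polynomial.aeval z G)) : False := by
  classical
  set g := G.natDegree with hg
  have hlcG : G.leadingCoeff ≠ 0 := leadingCoeff_ne_zero.2 hG
  have hXk : ∀ (k i : ℕ), (X ^ k * G).coeff i = if k ≤ i then G.coeff (i - k) else 0 := fun k i => by
    rw [coeff_X_pow_mul']
  have hX1 : ∀ i : ℕ, (X * G).coeff i = if 1 ≤ i then G.coeff (i - 1) else 0 := fun i => by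
    rw [← pow_one (X : ℝ[X]), hXk 1]
  have hGz : ∀ j, g < j → G.coeff j = 0 := fun j hj => coeff_eq_zero_of_natDegree_lt hj
  have hFz : ∀ j, g + 3 < j → F.coeff j = 0 := fun j hj => coeff_eq_zero_of_natDegree_lt (by omega)
  have hlcg : G.coeff g = G.leadingCoeff := rfl
  have hlcf : F.coeff (g + 3) = F.leadingCoeff := by rw [← hfg]; rfl
  -- the sub-leading constant and the index shift making the degree exactly `g + 2`
  set κ : ℝ := F.coeff (g + 2) + (X ^ 3 * G).coeff (g + 2) with hκ
  set N₀ : ℕ := ⌈|κ / (18 * G.leadingCoeff)|⌉₊ with hN₀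
  obtain ⟨s, hs⟩ : ∃ s : ℕ → ℝ, s = fun n => ((n + N₀ : ℕ) : ℝ) + 1 := ⟨_, rfl⟩
  have hs0 : ∀ n, 0 < s n := fun n => by rw [hs]; positivity
  have hsne : ∀ n, κ - 18 * s n * G.leadingCoeff ≠ 0 := by
    intro n h
    have h1 : s n = κ / (18 * G.leadingCoeff) := by
      field_simp; linarith
    have h2 : κ / (18 * G.leadingCoeff) ≤ N₀ := (le_abs_self _).trans (Nat.le_ceil _)
    have h3 : (N₀ : ℝ) < s n := by rw [hs]; push_cast; linarith
    linarith
  -- the pencil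
  set Φ : ℕ → ℝ[X] := fun n => F + (X ^ 3 - Polynomial.C (18 * s n) * X ^ 2 +
    Polynomial.C (48 * (s n) ^ 2) * X - Polynomial.C (32 * (s n) ^ 3)) * G with hΦ
  have hΦcoeff : ∀ n i, (Φ n).coeff i = F.coeff i + (X ^ 3 * G).coeff i - 18 * s n * (X ^ 2 * G).coeff i +
      48 * (s n) ^ 2 * (X * G).coeff i - 32 * (s n) ^ 3 * G.coeff i := by
    intro n i; rw [hΦ]; simp only []; rw [coeff_pencil]
  have hΦtop : ∀ n, (Φ n).coeff (g + 2) = κ - 18 * s n * G.leadingCoeff := by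
    intro n
    rw [hΦcoeff, hκ, hXk 2, if_pos (by omega), show g + 2 - 2 = g by omega, hlcg, hX1, if_pos (by omega),
      show g + 2 - 1 = g + 1 by omega, hGz (g + 1) (by omega), hGz (g + 2) (by omega)]
    ring
  have hΦhigh : ∀ n N, g + 2 < N → (Φ n).coeff N = 0 := by
    intro n N hN
    rw [hΦcoeff, hXk 3, hXk 2, hX1]
    rcases Nat.lt_or_ge (g + 3) N with h | h
    · rw [hFz N h, hGz N (by omega), if_pos (by omega), if_pos (by omega), if_pos (by omega), hGz _ (by omega),
        hGz _ (by omega), hGz _ (by omega)]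
      ring
    · have hN3 : N = g + 3 := by omega
      subst hN3
      rw [hlcf, if_pos (by omega), if_pos (by omega), if_pos (by omega), show g + 3 - 3 = g by omega, hlcg,
        hGz _ (by omega), hGz _ (by omega), hGz _ (by omega)]
      linear_combination hlc
  have hdeg : ∀ n, (Φ n).natDegree = g + 2 := by
    intro n
    refine natDegree_eq_of_le_of_coeff_ne_zero ?_ (by rw [hΦtop]; exact hsne n)
    exact (natDegree_le_iff_coeff_eq_zero).2 fun N hN => hΦhigh n N (by exact_mod_cast hN)
  -- the limit polynomial `−2 lc(G) X^g (3X − 4)²`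
  set q : ℝ[X] := -(Polynomial.C (18 * G.leadingCoeff) * X ^ (g + 2)) + Polynomial.C (48 * G.leadingCoeff) * X ^ (g + 1) -
    Polynomial.C (32 * G.leadingCoeff) * X ^ g with hq
  have hqcoeff : ∀ i, q.coeff i = -(if i = g + 2 then 18 * G.leadingCoeff else 0) +
      (if i = g + 1 then 48 * G.leadingCoeff else 0) - (if i = g then 32 * G.leadingCoeff else 0) := by
    intro i; rw [hq, coeff_sub, coeff_add, coeff_neg, coeff_C_mul_X_pow, coeff_C_mul_X_pow, coeff_C_mul_X_pow]
  have hqdeg : q.natDegree = g + 2 := by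
    refine le_antisymm ?_ (le_natDegree_of_ne_zero ?_)
    · rw [hq]
      refine (natDegree_sub_le _ _).trans (max_le ((natDegree_add_le _ _).trans (max_le ?_
        ((natDegree_C_mul_X_pow_le _ _).trans (by omega)))) ((natDegree_C_mul_X_pow_le _ _).trans (by omega)))
      rw [natDegree_neg]; exact natDegree_C_mul_X_pow_le _ _
    · rw [hqcoeff, if_pos rfl, if_neg (by omega), if_neg (by omega)]
      simp only [add_zero, sub_zero, neg_ne_zero]; exact mul_ne_zero (by norm_num) hlcG
  have hq0 : q ≠ 0 := by
    intro h; have := hqcoeff (g + 2)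
    rw [h, coeff_zero, if_pos rfl, if_neg (by omega), if_neg (by omega)] at this
    simp only [add_zero, sub_zero, zero_eq_neg] at this; exact mul_ne_zero (by norm_num) hlcG this
  -- rescaled roots
  have hS : IsClosed {w : ℂ | w.im = 0 ∧ w.re ≤ 1} :=
    (isClosed_eq Complex.continuous_im continuous_const).inter (isClosed_le Complex.continuous_re continuous_const)
  have hroots : ∀ (n : ℕ) (z : ℂ), Polynomial.aeval z (Φ n) = 0 →
      ((((s n)⁻¹ : ℝ) : ℂ) * z) ∈ {w : ℂ | w.im = 0 ∧ w.re ≤ 1} := by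
    intro n z hz
    rw [hΦ] at hz; simp only [] at hz
    rw [aeval_pencil] at hz
    obtain ⟨him, hre⟩ := hW (s n) (hs0 n).le z hz
    refine ⟨by rw [Complex.mul_im, Complex.ofReal_re, Complex.ofReal_im, him]; ring, ?_⟩
    rw [Complex.mul_re, Complex.ofReal_re, Complex.ofReal_im, him, mul_zero, sub_zero]
    rw [inv_mul_le_iff₀ (hs0 n)]; linarith
  -- coefficient convergence (with the shifted time `s n = (n + N₀) + 1`)
  have hshift : ∀ (a : ℝ) (u v : ℕ), u < v →
      Tendsto (fun n : ℕ => a * (s n) ^ u * ((s n)⁻¹) ^ v) atTop (𝓝 0) := by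
    intro a u v huv
    have h := (term_tendsto_zero a u v huv).comp (tendsto_add_atTop_nat N₀)
    rw [hs]; exact h
  have hfix : ∀ (a : ℝ) (u : ℕ) (n : ℕ), a * (s n) ^ u * ((s n)⁻¹) ^ u = a := by
    intro a u n; rw [hs]; exact term_eq a u (n + N₀)
  have hcoef : ∀ i : ℕ, Tendsto (fun n => (s n)⁻¹ * ((Φ n).coeff i * ((s n)⁻¹) ^ (g + 2 - i))) atTop (𝓝 (q.coeff i)) := by
    intro i
    rcases Nat.lt_or_ge (g + 2) i with hi | hi
    · -- above the degree: identically zero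
      rw [hqcoeff, if_neg (by omega), if_neg (by omega), if_neg (by omega)]
      simp only [neg_zero, add_zero, sub_zero]
      refine tendsto_const_nhds.congr fun n => ?_
      rw [hΦhigh n i hi]; ring
    · have hform : ∀ n : ℕ, (s n)⁻¹ * ((Φ n).coeff i * ((s n)⁻¹) ^ (g + 2 - i)) =
          F.coeff i * (s n) ^ 0 * ((s n)⁻¹) ^ (g + 3 - i) +
          (X ^ 3 * G).coeff i * (s n) ^ 0 * ((s n)⁻¹) ^ (g + 3 - i) -
          18 * (X ^ 2 * G).coeff i * (s n) ^ 1 * ((s n)⁻¹) ^ (g + 3 - i) +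
          48 * (X * G).coeff i * (s n) ^ 2 * ((s n)⁻¹) ^ (g + 3 - i) -
          32 * G.coeff i * (s n) ^ 3 * ((s n)⁻¹) ^ (g + 3 - i) := by
        intro n
        rw [hΦcoeff, show g + 3 - i = (g + 2 - i) + 1 by omega, pow_succ]
        ring
      simp_rw [hform]
      have hA : Tendsto (fun n : ℕ => F.coeff i * (s n) ^ 0 * ((s n)⁻¹) ^ (g + 3 - i)) atTop (𝓝 0) :=
        hshift _ _ _ (by omega)
      have hB : Tendsto (fun n : ℕ => (X ^ 3 * G).coeff i * (s n) ^ 0 * ((s n)⁻¹) ^ (g + 3 - i)) atTop (𝓝 0) :=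
        hshift _ _ _ (by omega)
      have hC : Tendsto (fun n : ℕ => 18 * (X ^ 2 * G).coeff i * (s n) ^ 1 * ((s n)⁻¹) ^ (g + 3 - i)) atTop
          (𝓝 (if i = g + 2 then 18 * G.leadingCoeff else 0)) := by
        rw [hXk 2]
        by_cases hi2 : i = g + 2
        · rw [if_pos hi2, if_pos (by omega), show i - 2 = g by omega, hlcg, show g + 3 - i = 1 by omega]
          exact tendsto_const_nhds.congr fun n => (hfix _ 1 n).symm
        · rw [if_neg hi2]
          split_ifs with h2
          · by_cases hGi : G.coeff (i - 2) = 0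
            · simp only [hGi, mul_zero, zero_mul]; exact tendsto_const_nhds
            · have := le_natDegree_of_ne_zero hGi
              exact hshift _ _ _ (by omega)
          · simp only [mul_zero, zero_mul]; exact tendsto_const_nhds
      have hD : Tendsto (fun n : ℕ => 48 * (X * G).coeff i * (s n) ^ 2 * ((s n)⁻¹) ^ (g + 3 - i)) atTop
          (𝓝 (if i = g + 1 then 48 * G.leadingCoeff else 0)) := by
        rw [hX1]
        by_cases hi1 : i = g + 1
        · rw [if_pos hi1, if_pos (by omega), show i - 1 = g by omega, hlcg, show g + 3 - i = 2 by omega]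
          exact tendsto_const_nhds.congr fun n => (hfix _ 2 n).symm
        · rw [if_neg hi1]
          split_ifs with h1
          · by_cases hGi : G.coeff (i - 1) = 0
            · simp only [hGi, mul_zero, zero_mul]; exact tendsto_const_nhds
            · have := le_natDegree_of_ne_zero hGi
              exact hshift _ _ _ (by omega)
          · simp only [mul_zero, zero_mul]; exact tendsto_const_nhds
      have hE : Tendsto (fun n : ℕ => 32 * G.coeff i * (s n) ^ 3 * ((s n)⁻¹) ^ (g + 3 - i)) atTop
          (𝓝 (if i = g then 32 * G.leadingCoeff else 0)) := by
        by_cases hi0 : i = g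
        · rw [if_pos hi0, hi0, hlcg, show g + 3 - g = 3 by omega]
          exact tendsto_const_nhds.congr fun n => (hfix _ 3 n).symm
        · rw [if_neg hi0]
          by_cases hGi : G.coeff i = 0
          · simp only [hGi, mul_zero, zero_mul]; exact tendsto_const_nhds
          · have := le_natDegree_of_ne_zero hGi
            exact hshift _ _ _ (by omega)
      have hsum := (((hA.add hB).sub hC).add hD).sub hE
      rw [add_zero, zero_sub] at hsum
      rw [hqcoeff]
      exact hsum
  have hmem := rescaled_roots_mem Φ (g + 2) hdeg (fun n => (s n)⁻¹) (fun n => (s n)⁻¹)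
    (fun n => inv_ne_zero (hs0 n).ne') (fun n => inv_ne_zero (hs0 n).ne') _ hS hroots q hqdeg hq0 hcoef
  -- the root `4/3`
  have h43 : Polynomial.aeval ((4 / 3 : ℝ) : ℂ) q = 0 := by
    rw [hq]; simp only [map_sub, map_add, map_neg, map_mul, map_pow, Polynomial.aeval_X, Polynomial.aeval_C,
      Complex.coe_algebraMap]
    push_cast
    ring
  have := (hmem _ h43).2
  rw [Complex.ofReal_re] at this
  norm_num at this

end Summit.QuantumFields.YangMills.Cruxes.RationalToGeneral.HexagonNormalForm
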